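import Mathlib
import HarnessLib
import Summits.Ventures.LatticeQCDFlow.Exactness.NCMCGeneralSpaceOccupancyChainErgodic
import Summits.Ventures.LatticeQCDFlow.Exactness.NCMCGeneralSpaceErgodicRunPairs

/-!
# The NCMC lane's reported acceptance rates are consistent: `acc_fwd → a_F(c) = E_{P_F} min(1, e^{−(W−c)})`, `acc_rev → a_R(c)` almost surely

HONEST FRAMING: exact (Metropolis-corrected) sampling algorithms for lattice gauge theory;
figures of merit are autocorrelation/cost numbers at stated couplings and volumes; no
continuum-physics claim.

Venture `LatticeQCDFlow` (cell pub-lqcd), topic `Exactness`; FANOUT row 13 (`eng-snf`, GEN-17).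
NEW WORK of the cell, not a published result; no definition is introduced; nothing is cited as a
fact.  Completes the typed dictionary of the numbers `latflow-snf`'s `run_ncmc_chain` reports
(`NCMCGeneralSpaceOccupancyChain*.lean`: occupancy, `dF_occ`, target-level means) with the two LANE
ACCEPTANCE RATES `acc_fwd` = accepted up-switches / iterations spent on the prior level and
`acc_rev` = accepted down-switches / iterations spent on the target level.  These are two-time
averages (a switch is read off two consecutive states), handled by
`NCMCGeneralSpaceErgodicRunPairs.tendsto_transitionRate_ae_chain`.  In population
(`NCMCGeneralSpaceOccupancy.one_sub_occupancy_mul_accept_eq`) the three limits satisfy the flow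
balance `(1 − p(c)) a_F(c) = p(c) a_R(c)`.

## Content (iteration kernel `Q = switchKernel κF κR c W s e ∘ₖ levelKernel T₀ T₁`, `T_k` Markov and
## `ν_k`-invariant; `P_F = fwdPathLaw ν₀ κF`, `P_R = fwdPathLaw ν₁ κR`)

* §1 `switchKernel_prior_targetLevel` / `switchKernel_target_priorLevel` (one switch changes level
  with probability `F_c(x, Ω)` / `R_c(y, Ω)`); `iteration_prior_targetLevel` /
  `iteration_target_priorLevel`; **`setLIntegral_iteration_prior_targetLevel`** —
  `∫_{prior} Q(z, target) dΠ_c = ∫ F_c(x, Ω) dν₀` (invariance of `T₀` absorbs the relaxation);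
  **`setLIntegral_iteration_target_priorLevel`** — `∫_{target} Q(z, prior) dΠ_c = e^{c} ∫ R_c(y, Ω) dν₁`;
  `lintegral_fwdFlow_univ_eq_mul_fwdPathLaw` / `lintegral_revFlow_univ_eq_mul_fwdPathLaw`
  (`∫ F_c(x, Ω) dν₀ = Z₀ · E_{P_F} accF`),
  `toReal_lintegral_accF` / `toReal_lintegral_accR`.
* §2 **`CrooksPair.tendsto_fwdAcceptRate_ae_chain`** — IF the chain started in `π_c` is ergodic:
  `#{i<n : prior at i, target at i+1} / #{i<n : prior at i} → a_F(c) = ∫ min(1, e^{−(W−c)}) dP_F`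
  almost surely; **`CrooksPair.tendsto_revAcceptRate_ae_chain`** — `acc_rev → a_R(c) =
  ∫ min(1, e^{W−c}) dP_R` almost surely.
* §3 **`CrooksPair.tendsto_fwdAcceptRate_ae_ncmcChain`** / **`…revAcceptRate…`** — unconditionally,
  under GEN-17's certificate (level samplers minorised by non-zero measures).

NOT CLAIMED: rates or error bars; anything about a concrete protocol's `a_F`, `a_R`.
-/

namespace Summit.Ventures.LatticeQCDFlow.Exactness.GeneralNCMC

open MeasureTheory ProbabilityTheory Set Filter Finset
open scoped ENNReal Topology

variable {Ω E : Type*} [MeasurableSpace Ω] [MeasurableSpace E]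

/-! ## §1 One-step switch probabilities in stationarity -/

section Step

variable {κF κR : Kernel Ω E} [IsMarkovKernel κF] [IsMarkovKernel κR] {c : ℝ} {W : E → ℝ}
  {s e : E → Ω} (T₀ T₁ : Kernel Ω Ω)

omit [MeasurableSpace Ω] [IsMarkovKernel κF] [IsMarkovKernel κR] in
/-- The prior level seen from the target tag and from the prior tag. -/
theorem preimage_targetLevel_compl :
    Prod.mk true ⁻¹' (targetLevel Ω)ᶜ = (∅ : Set Ω) ∧ Prod.mk false ⁻¹' (targetLevel Ω)ᶜ = univ := by
  constructor
  · ext y; simp [targetLevel]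
  · ext x; simp [targetLevel]

omit [MeasurableSpace Ω] [IsMarkovKernel κF] [IsMarkovKernel κR] in
/-- The target level seen from the target tag and from the prior tag. -/
theorem preimage_targetLevel :
    Prod.mk true ⁻¹' targetLevel Ω = (univ : Set Ω) ∧ Prod.mk false ⁻¹' targetLevel Ω = ∅ := by
  constructor
  · ext y; simp [targetLevel]
  · ext x; simp [targetLevel]

/-- From a prior state one switch reaches the target level with probability `F_c(x, Ω)`. -/
theorem switchKernel_prior_targetLevel (hW : Measurable W) (he : Measurable e) (x : Ω) :
    switchKernel κF κR c W s e (false, x) (targetLevel Ω) = fwdFlow κF c W e x univ := by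
  rw [switchKernel_apply_prior hW he x measurableSet_targetLevel, preimage_targetLevel.1,
    Set.indicator_of_notMem (show (false, x) ∉ targetLevel Ω by simp), mul_zero, add_zero]

/-- From a target state one switch reaches the prior level with probability `R_c(y, Ω)`. -/
theorem switchKernel_target_priorLevel (hW : Measurable W) (hs : Measurable s) (y : Ω) :
    switchKernel κF κR c W s e (true, y) (targetLevel Ω)ᶜ = revFlow κR c W s y univ := by
  rw [switchKernel_apply_target hW hs y measurableSet_targetLevel.compl,
    (preimage_targetLevel_compl (Ω := Ω)).2,
    Set.indicator_of_notMem (show (true, y) ∉ (targetLevel Ω)ᶜ by simp), mul_zero, add_zero]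

/-- From a prior state one iteration reaches the target level with probability
`∫ F_c(x', Ω) dT₀(x, x')`. -/
theorem iteration_prior_targetLevel (hW : Measurable W) (he : Measurable e) (x : Ω) :
    (switchKernel κF κR c W s e ∘ₖ levelKernel T₀ T₁) (false, x) (targetLevel Ω) =
      ∫⁻ x', fwdFlow κF c W e x' univ ∂(T₀ x) := by
  rw [iteration_apply_prior T₀ T₁ x measurableSet_targetLevel]
  simp_rw [switchKernel_prior_targetLevel hW he]

/-- From a target state one iteration reaches the prior level with probability
`∫ R_c(y', Ω) dT₁(y, y')`. -/
theorem iteration_target_priorLevel (hW : Measurable W) (hs : Measurable s) (y : Ω) :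
    (switchKernel κF κR c W s e ∘ₖ levelKernel T₀ T₁) (true, y) (targetLevel Ω)ᶜ =
      ∫⁻ y', revFlow κR c W s y' univ ∂(T₁ y) := by
  rw [iteration_apply_target T₀ T₁ y measurableSet_targetLevel.compl]
  simp_rw [switchKernel_target_priorLevel hW hs]

/-- **The stationary up-switch flow**: `∫_{prior} Q(z, target) dΠ_c = ∫ F_c(x, Ω) dν₀` — the
relaxation `T₀` disappears by invariance. -/
theorem setLIntegral_iteration_prior_targetLevel (hW : Measurable W) (he : Measurable e)
    (ν₀ ν₁ : Measure Ω) (hT₀ : Kernel.Invariant T₀ ν₀) :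
    ∫⁻ z in (targetLevel Ω)ᶜ, (switchKernel κF κR c W s e ∘ₖ levelKernel T₀ T₁) z (targetLevel Ω)
        ∂(jointWeight c ν₀ ν₁) = ∫⁻ x, fwdFlow κF c W e x univ ∂ν₀ := by
  rw [setLIntegral_jointWeight c ν₀ ν₁ measurableSet_targetLevel.compl
    (Kernel.measurable_coe _ measurableSet_targetLevel), (preimage_targetLevel_compl (Ω := Ω)).1,
    (preimage_targetLevel_compl (Ω := Ω)).2, Measure.restrict_univ, Measure.restrict_empty,
    lintegral_zero_measure, mul_zero, add_zero]
  simp_rw [iteration_prior_targetLevel T₀ T₁ hW he]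
  rw [← Measure.lintegral_bind (Kernel.aemeasurable T₀)
    (measurable_fwdFlow κF c hW he MeasurableSet.univ).aemeasurable, hT₀.def]

/-- **The stationary down-switch flow**: `∫_{target} Q(z, prior) dΠ_c = e^{c} ∫ R_c(y, Ω) dν₁`. -/
theorem setLIntegral_iteration_target_priorLevel (hW : Measurable W) (hs : Measurable s)
    (ν₀ ν₁ : Measure Ω) (hT₁ : Kernel.Invariant T₁ ν₁) :
    ∫⁻ z in targetLevel Ω, (switchKernel κF κR c W s e ∘ₖ levelKernel T₀ T₁) z (targetLevel Ω)ᶜ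
        ∂(jointWeight c ν₀ ν₁) =
      ENNReal.ofReal (Real.exp c) * ∫⁻ y, revFlow κR c W s y univ ∂ν₁ := by
  rw [setLIntegral_jointWeight c ν₀ ν₁ measurableSet_targetLevel
    (Kernel.measurable_coe _ measurableSet_targetLevel.compl), preimage_targetLevel.1,
    preimage_targetLevel.2, Measure.restrict_univ, Measure.restrict_empty,
    lintegral_zero_measure, zero_add]
  simp_rw [iteration_target_priorLevel T₀ T₁ hW hs]
  rw [← Measure.lintegral_bind (Kernel.aemeasurable T₁)
    (measurable_revFlow κR c hW hs MeasurableSet.univ).aemeasurable, hT₁.def]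

omit [IsMarkovKernel κF] in
/-- `∫ F_c(x, Ω) dν₀ = Z₀ · ∫ accF dP_F` (finite non-zero `Z₀`). -/
theorem lintegral_fwdFlow_univ_eq_mul_fwdPathLaw (hW : Measurable W) (ν₀ : Measure Ω)
    [IsFiniteMeasure ν₀] (h0 : ν₀ univ ≠ 0) :
    ∫⁻ x, fwdFlow κF c W e x univ ∂ν₀ = ν₀ univ * ∫⁻ ε, accF c W ε ∂(fwdPathLaw ν₀ κF) := by
  rw [fwdPathLaw, lintegral_smul_measure, smul_eq_mul, ← mul_assoc,
    ENNReal.mul_inv_cancel h0 (measure_ne_top ν₀ univ), one_mul,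
    Measure.lintegral_bind (Kernel.aemeasurable κF) (measurable_accF c hW).aemeasurable]
  simp_rw [fwdFlow_univ]

omit [IsMarkovKernel κR] in
/-- `∫ R_c(y, Ω) dν₁ = Z₁ · ∫ accR dP_R` (finite non-zero `Z₁`). -/
theorem lintegral_revFlow_univ_eq_mul_fwdPathLaw (hW : Measurable W) (ν₁ : Measure Ω)
    [IsFiniteMeasure ν₁] (h1 : ν₁ univ ≠ 0) :
    ∫⁻ y, revFlow κR c W s y univ ∂ν₁ = ν₁ univ * ∫⁻ ε, accR c W ε ∂(fwdPathLaw ν₁ κR) := by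
  rw [fwdPathLaw, lintegral_smul_measure, smul_eq_mul, ← mul_assoc,
    ENNReal.mul_inv_cancel h1 (measure_ne_top ν₁ univ), one_mul,
    Measure.lintegral_bind (Kernel.aemeasurable κR) (measurable_accR c hW).aemeasurable]
  simp_rw [revFlow_univ]

omit [MeasurableSpace Ω] [IsMarkovKernel κF] [IsMarkovKernel κR] in
/-- The forward lane acceptance as a real expectation: `(∫ accF dμ).toReal = ∫ min(1, e^{−(W−c)}) dμ`. -/
theorem toReal_lintegral_accF (hW : Measurable W) (μ : Measure E) :
    (∫⁻ ε, accF c W ε ∂μ).toReal = ∫ ε, min 1 (Real.exp (-(W ε - c))) ∂μ := by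
  have hm : Measurable fun ε => min 1 (Real.exp (-(W ε - c))) :=
    measurable_const.min (Real.measurable_exp.comp (hW.sub measurable_const).neg)
  rw [integral_eq_lintegral_of_nonneg_ae
    (Eventually.of_forall fun ε => le_min zero_le_one (Real.exp_pos _).le) hm.aestronglyMeasurable]
  rfl

omit [MeasurableSpace Ω] [IsMarkovKernel κF] [IsMarkovKernel κR] in
/-- The reverse lane acceptance as a real expectation: `(∫ accR dμ).toReal = ∫ min(1, e^{W−c}) dμ`. -/
theorem toReal_lintegral_accR (hW : Measurable W) (μ : Measure E) :
    (∫⁻ ε, accR c W ε ∂μ).toReal = ∫ ε, min 1 (Real.exp (W ε - c)) ∂μ := by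
  have hm : Measurable fun ε => min 1 (Real.exp (W ε - c)) :=
    measurable_const.min (Real.measurable_exp.comp (hW.sub measurable_const))
  rw [integral_eq_lintegral_of_nonneg_ae
    (Eventually.of_forall fun ε => le_min zero_le_one (Real.exp_pos _).le) hm.aestronglyMeasurable]
  rfl

end Step

/-! ## §2 Along an ergodic chain the reported lane acceptance rates are consistent -/

namespace CrooksPair

variable {ν₀ ν₁ : Measure Ω} [IsFiniteMeasure ν₀] [IsFiniteMeasure ν₁] {κF κR : Kernel Ω E}
  [IsMarkovKernel κF] [IsMarkovKernel κR] {s e : E → Ω} {W : E → ℝ} {T₀ T₁ : Kernel Ω Ω}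
  [IsMarkovKernel T₀] [IsMarkovKernel T₁]

/-- **`acc_fwd → a_F(c)` ALMOST SURELY.**  If the expanded-ensemble chain of the iteration kernel
`switchKernel ∘ₖ levelKernel T₀ T₁` started in `π_c` is ergodic, the reported forward acceptance
rate — accepted up-switches over iterations spent on the prior level — converges to the lane
acceptance `a_F(c) = ∫ min(1, e^{−(W−c)}) dP_F` almost surely. -/
theorem tendsto_fwdAcceptRate_ae_chain (h : CrooksPair ν₀ ν₁ κF κR s e W) (h0 : ν₀ univ ≠ 0)
    (hT₀ : Kernel.Invariant T₀ ν₀) (hT₁ : Kernel.Invariant T₁ ν₁) (c : ℝ)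
    (hErg :
      haveI := isMarkovKernel_switchKernel (κF := κF) (κR := κR) (c := c)
        h.measurable_W h.measurable_s h.measurable_e
      haveI := isMarkovKernel_levelKernel T₀ T₁
      haveI := isProbabilityMeasure_jointLaw c ν₀ ν₁ h0
      Ergodic (fun (z : ℕ → Bool × Ω) (k : ℕ) => z (k + 1))
        (Kernel.trajMeasure (X := fun _ : ℕ => Bool × Ω)
          ((jointWeight c ν₀ ν₁ univ)⁻¹ • jointWeight c ν₀ ν₁)
          (fun n : ℕ => (switchKernel κF κR c W s e ∘ₖ levelKernel T₀ T₁).comap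
            (fun hh : (j : ↥(Finset.Iic n)) → Bool × Ω => hh ⟨n, Finset.mem_Iic.2 le_rfl⟩)
            (measurable_pi_apply _)))) :
    haveI := isMarkovKernel_switchKernel (κF := κF) (κR := κR) (c := c)
      h.measurable_W h.measurable_s h.measurable_e
    haveI := isMarkovKernel_levelKernel T₀ T₁
    haveI := isProbabilityMeasure_jointLaw c ν₀ ν₁ h0
    ∀ᵐ z ∂(Kernel.trajMeasure (X := fun _ : ℕ => Bool × Ω)
        ((jointWeight c ν₀ ν₁ univ)⁻¹ • jointWeight c ν₀ ν₁)
        (fun n : ℕ => (switchKernel κF κR c W s e ∘ₖ levelKernel T₀ T₁).comap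
          (fun hh : (j : ↥(Finset.Iic n)) → Bool × Ω => hh ⟨n, Finset.mem_Iic.2 le_rfl⟩)
          (measurable_pi_apply _))),
      Tendsto (fun n : ℕ =>
          (∑ i ∈ range n, (targetLevel Ω)ᶜ.indicator (1 : Bool × Ω → ℝ) (z i) *
              (targetLevel Ω).indicator (1 : Bool × Ω → ℝ) (z (i + 1))) /
            ∑ i ∈ range n, (targetLevel Ω)ᶜ.indicator (1 : Bool × Ω → ℝ) (z i))
        atTop (𝓝 (∫ ε, min 1 (Real.exp (-(W ε - c))) ∂(fwdPathLaw ν₀ κF))) := by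
  haveI := isMarkovKernel_switchKernel (κF := κF) (κR := κR) (c := c)
    h.measurable_W h.measurable_s h.measurable_e
  haveI := isMarkovKernel_levelKernel T₀ T₁
  haveI := isProbabilityMeasure_jointLaw c ν₀ ν₁ h0
  haveI := isFiniteMeasure_jointWeight c ν₀ ν₁
  set Q := switchKernel κF κR c W s e ∘ₖ levelKernel T₀ T₁ with hQ
  have hπ : Kernel.Invariant Q ((jointWeight c ν₀ ν₁ univ)⁻¹ • jointWeight c ν₀ ν₁) :=
    invariant_smul Q (iteration_invariant h hT₀ hT₁ c) _
  have hJ0 : jointWeight c ν₀ ν₁ univ ≠ 0 := jointWeight_univ_ne_zero c ν₀ ν₁ h0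
  have hJtop : jointWeight c ν₀ ν₁ univ ≠ ∞ := measure_ne_top _ _
  have hF0 : ((jointWeight c ν₀ ν₁ univ)⁻¹ • jointWeight c ν₀ ν₁) (targetLevel Ω)ᶜ ≠ 0 := by
    rw [Measure.smul_apply, smul_eq_mul, jointWeight_compl_targetLevel]
    exact mul_ne_zero (ENNReal.inv_ne_zero.2 hJtop) h0
  have key := tendsto_transitionRate_ae_chain Q hErg hπ measurableSet_targetLevel.compl
    measurableSet_targetLevel hF0
  -- the limit: `∫_{prior} Q(z, target) dπ_c / π_c(prior) = a_F(c)`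
  have hnum : ∫ z in (targetLevel Ω)ᶜ, (Q z).real (targetLevel Ω)
      ∂((jointWeight c ν₀ ν₁ univ)⁻¹ • jointWeight c ν₀ ν₁) =
      ((jointWeight c ν₀ ν₁ univ)⁻¹ * (ν₀ univ * ∫⁻ ε, accF c W ε ∂(fwdPathLaw ν₀ κF))).toReal := by
    simp_rw [measureReal_def]
    rw [integral_toReal (Kernel.measurable_coe Q measurableSet_targetLevel).aemeasurable
      (Eventually.of_forall fun z => measure_lt_top _ _), Measure.restrict_smul,
      lintegral_smul_measure, smul_eq_mul,
      setLIntegral_iteration_prior_targetLevel T₀ T₁ h.measurable_W h.measurable_e ν₀ ν₁ hT₀,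
      lintegral_fwdFlow_univ_eq_mul_fwdPathLaw h.measurable_W ν₀ h0]
  have hden : ((jointWeight c ν₀ ν₁ univ)⁻¹ • jointWeight c ν₀ ν₁).real (targetLevel Ω)ᶜ =
      ((jointWeight c ν₀ ν₁ univ)⁻¹ * ν₀ univ).toReal := by
    rw [measureReal_def, Measure.smul_apply, smul_eq_mul, jointWeight_compl_targetLevel]
  have hval : (∫ z in (targetLevel Ω)ᶜ, (Q z).real (targetLevel Ω)
      ∂((jointWeight c ν₀ ν₁ univ)⁻¹ • jointWeight c ν₀ ν₁)) /
      ((jointWeight c ν₀ ν₁ univ)⁻¹ • jointWeight c ν₀ ν₁).real (targetLevel Ω)ᶜ =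
      ∫ ε, min 1 (Real.exp (-(W ε - c))) ∂(fwdPathLaw ν₀ κF) := by
    rw [hnum, hden, ← mul_assoc, ENNReal.toReal_mul, ← toReal_lintegral_accF h.measurable_W]
    have hne : ((jointWeight c ν₀ ν₁ univ)⁻¹ * ν₀ univ).toReal ≠ 0 := by
      rw [ENNReal.toReal_ne_zero]
      exact ⟨mul_ne_zero (ENNReal.inv_ne_zero.2 hJtop) h0,
        ENNReal.mul_ne_top (ENNReal.inv_ne_top.2 hJ0) (measure_ne_top ν₀ univ)⟩
    rw [mul_div_cancel_left₀ _ hne]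
  rw [hval] at key
  exact key

/-- **`acc_rev → a_R(c)` ALMOST SURELY.**  Under the same ergodicity, the reported reverse acceptance
rate — accepted down-switches over iterations spent on the target level — converges to
`a_R(c) = ∫ min(1, e^{W−c}) dP_R` almost surely (`Z₁ ≠ 0`). -/
theorem tendsto_revAcceptRate_ae_chain (h : CrooksPair ν₀ ν₁ κF κR s e W) (h0 : ν₀ univ ≠ 0)
    (h1 : ν₁ univ ≠ 0) (hT₀ : Kernel.Invariant T₀ ν₀) (hT₁ : Kernel.Invariant T₁ ν₁) (c : ℝ)
    (hErg :
      haveI := isMarkovKernel_switchKernel (κF := κF) (κR := κR) (c := c)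
        h.measurable_W h.measurable_s h.measurable_e
      haveI := isMarkovKernel_levelKernel T₀ T₁
      haveI := isProbabilityMeasure_jointLaw c ν₀ ν₁ h0
      Ergodic (fun (z : ℕ → Bool × Ω) (k : ℕ) => z (k + 1))
        (Kernel.trajMeasure (X := fun _ : ℕ => Bool × Ω)
          ((jointWeight c ν₀ ν₁ univ)⁻¹ • jointWeight c ν₀ ν₁)
          (fun n : ℕ => (switchKernel κF κR c W s e ∘ₖ levelKernel T₀ T₁).comap
            (fun hh : (j : ↥(Finset.Iic n)) → Bool × Ω => hh ⟨n, Finset.mem_Iic.2 le_rfl⟩)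
            (measurable_pi_apply _)))) :
    haveI := isMarkovKernel_switchKernel (κF := κF) (κR := κR) (c := c)
      h.measurable_W h.measurable_s h.measurable_e
    haveI := isMarkovKernel_levelKernel T₀ T₁
    haveI := isProbabilityMeasure_jointLaw c ν₀ ν₁ h0
    ∀ᵐ z ∂(Kernel.trajMeasure (X := fun _ : ℕ => Bool × Ω)
        ((jointWeight c ν₀ ν₁ univ)⁻¹ • jointWeight c ν₀ ν₁)
        (fun n : ℕ => (switchKernel κF κR c W s e ∘ₖ levelKernel T₀ T₁).comap
          (fun hh : (j : ↥(Finset.Iic n)) → Bool × Ω => hh ⟨n, Finset.mem_Iic.2 le_rfl⟩)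
          (measurable_pi_apply _))),
      Tendsto (fun n : ℕ =>
          (∑ i ∈ range n, (targetLevel Ω).indicator (1 : Bool × Ω → ℝ) (z i) *
              (targetLevel Ω)ᶜ.indicator (1 : Bool × Ω → ℝ) (z (i + 1))) /
            ∑ i ∈ range n, (targetLevel Ω).indicator (1 : Bool × Ω → ℝ) (z i))
        atTop (𝓝 (∫ ε, min 1 (Real.exp (W ε - c)) ∂(fwdPathLaw ν₁ κR))) := by
  haveI := isMarkovKernel_switchKernel (κF := κF) (κR := κR) (c := c)
    h.measurable_W h.measurable_s h.measurable_e
  haveI := isMarkovKernel_levelKernel T₀ T₁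
  haveI := isProbabilityMeasure_jointLaw c ν₀ ν₁ h0
  haveI := isFiniteMeasure_jointWeight c ν₀ ν₁
  set Q := switchKernel κF κR c W s e ∘ₖ levelKernel T₀ T₁ with hQ
  have hπ : Kernel.Invariant Q ((jointWeight c ν₀ ν₁ univ)⁻¹ • jointWeight c ν₀ ν₁) :=
    invariant_smul Q (iteration_invariant h hT₀ hT₁ c) _
  have hJ0 : jointWeight c ν₀ ν₁ univ ≠ 0 := jointWeight_univ_ne_zero c ν₀ ν₁ h0
  have hJtop : jointWeight c ν₀ ν₁ univ ≠ ∞ := measure_ne_top _ _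
  have hec : ENNReal.ofReal (Real.exp c) ≠ 0 := by
    rw [ne_eq, ENNReal.ofReal_eq_zero, not_le]; exact Real.exp_pos c
  have hT0 : ((jointWeight c ν₀ ν₁ univ)⁻¹ • jointWeight c ν₀ ν₁) (targetLevel Ω) ≠ 0 := by
    rw [Measure.smul_apply, smul_eq_mul, jointWeight_targetLevel]
    exact mul_ne_zero (ENNReal.inv_ne_zero.2 hJtop) (mul_ne_zero hec h1)
  have key := tendsto_transitionRate_ae_chain Q hErg hπ measurableSet_targetLevel
    measurableSet_targetLevel.compl hT0
  have hnum : ∫ z in targetLevel Ω, (Q z).real (targetLevel Ω)ᶜ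
      ∂((jointWeight c ν₀ ν₁ univ)⁻¹ • jointWeight c ν₀ ν₁) =
      ((jointWeight c ν₀ ν₁ univ)⁻¹ * (ENNReal.ofReal (Real.exp c) *
        (ν₁ univ * ∫⁻ ε, accR c W ε ∂(fwdPathLaw ν₁ κR)))).toReal := by
    simp_rw [measureReal_def]
    rw [integral_toReal (Kernel.measurable_coe Q measurableSet_targetLevel.compl).aemeasurable
      (Eventually.of_forall fun z => measure_lt_top _ _), Measure.restrict_smul,
      lintegral_smul_measure, smul_eq_mul,
      setLIntegral_iteration_target_priorLevel T₀ T₁ h.measurable_W h.measurable_s ν₀ ν₁ hT₁,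
      lintegral_revFlow_univ_eq_mul_fwdPathLaw h.measurable_W ν₁ h1]
  have hden : ((jointWeight c ν₀ ν₁ univ)⁻¹ • jointWeight c ν₀ ν₁).real (targetLevel Ω) =
      ((jointWeight c ν₀ ν₁ univ)⁻¹ * (ENNReal.ofReal (Real.exp c) * ν₁ univ)).toReal := by
    rw [measureReal_def, Measure.smul_apply, smul_eq_mul, jointWeight_targetLevel]
  have hval : (∫ z in targetLevel Ω, (Q z).real (targetLevel Ω)ᶜ
      ∂((jointWeight c ν₀ ν₁ univ)⁻¹ • jointWeight c ν₀ ν₁)) /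
      ((jointWeight c ν₀ ν₁ univ)⁻¹ • jointWeight c ν₀ ν₁).real (targetLevel Ω) =
      ∫ ε, min 1 (Real.exp (W ε - c)) ∂(fwdPathLaw ν₁ κR) := by
    rw [hnum, hden, show (jointWeight c ν₀ ν₁ univ)⁻¹ * (ENNReal.ofReal (Real.exp c) *
        (ν₁ univ * ∫⁻ ε, accR c W ε ∂(fwdPathLaw ν₁ κR))) =
        (jointWeight c ν₀ ν₁ univ)⁻¹ * (ENNReal.ofReal (Real.exp c) * ν₁ univ) *
          ∫⁻ ε, accR c W ε ∂(fwdPathLaw ν₁ κR) by ring, ENNReal.toReal_mul,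
      ← toReal_lintegral_accR h.measurable_W]
    have hne : ((jointWeight c ν₀ ν₁ univ)⁻¹ * (ENNReal.ofReal (Real.exp c) * ν₁ univ)).toReal ≠ 0 := by
      rw [ENNReal.toReal_ne_zero]
      exact ⟨mul_ne_zero (ENNReal.inv_ne_zero.2 hJtop) (mul_ne_zero hec h1),
        ENNReal.mul_ne_top (ENNReal.inv_ne_top.2 hJ0)
          (ENNReal.mul_ne_top ENNReal.ofReal_ne_top (measure_ne_top ν₁ univ))⟩
    rw [mul_div_cancel_left₀ _ hne]
  rw [hval] at key
  exact key

/-! ## §3 Unconditionally, under the certificate -/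

variable {m₀ m₁ : Measure Ω} [IsFiniteMeasure m₀] [IsFiniteMeasure m₁]

/-- **`acc_fwd → a_F(c)` almost surely, unconditionally**, for level samplers leaving their weights
invariant and minorised by non-zero measures. -/
theorem tendsto_fwdAcceptRate_ae_ncmcChain (h : CrooksPair ν₀ ν₁ κF κR s e W) (h0 : ν₀ univ ≠ 0)
    (h1 : ν₁ univ ≠ 0) (hT₀ : Kernel.Invariant T₀ ν₀) (hT₁ : Kernel.Invariant T₁ ν₁)
    (hm₀ : m₀ univ ≠ 0) (hm₁ : m₁ univ ≠ 0) (hmin₀ : ∀ z, m₀ ≤ T₀ z) (hmin₁ : ∀ z, m₁ ≤ T₁ z)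
    (c : ℝ) :
    haveI := isMarkovKernel_switchKernel (κF := κF) (κR := κR) (c := c)
      h.measurable_W h.measurable_s h.measurable_e
    haveI := isMarkovKernel_levelKernel T₀ T₁
    haveI := isProbabilityMeasure_jointLaw c ν₀ ν₁ h0
    ∀ᵐ z ∂(Kernel.trajMeasure (X := fun _ : ℕ => Bool × Ω)
        ((jointWeight c ν₀ ν₁ univ)⁻¹ • jointWeight c ν₀ ν₁)
        (fun n : ℕ => (switchKernel κF κR c W s e ∘ₖ levelKernel T₀ T₁).comap
          (fun hh : (j : ↥(Finset.Iic n)) → Bool × Ω => hh ⟨n, Finset.mem_Iic.2 le_rfl⟩)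
          (measurable_pi_apply _))),
      Tendsto (fun n : ℕ =>
          (∑ i ∈ range n, (targetLevel Ω)ᶜ.indicator (1 : Bool × Ω → ℝ) (z i) *
              (targetLevel Ω).indicator (1 : Bool × Ω → ℝ) (z (i + 1))) /
            ∑ i ∈ range n, (targetLevel Ω)ᶜ.indicator (1 : Bool × Ω → ℝ) (z i))
        atTop (𝓝 (∫ ε, min 1 (Real.exp (-(W ε - c))) ∂(fwdPathLaw ν₀ κF))) :=
  h.tendsto_fwdAcceptRate_ae_chain h0 hT₀ hT₁ c
    (h.ergodic_ncmcChain h0 h1 hT₀ hT₁ hm₀ hm₁ hmin₀ hmin₁ c)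

/-- **`acc_rev → a_R(c)` almost surely, unconditionally.** -/
theorem tendsto_revAcceptRate_ae_ncmcChain (h : CrooksPair ν₀ ν₁ κF κR s e W) (h0 : ν₀ univ ≠ 0)
    (h1 : ν₁ univ ≠ 0) (hT₀ : Kernel.Invariant T₀ ν₀) (hT₁ : Kernel.Invariant T₁ ν₁)
    (hm₀ : m₀ univ ≠ 0) (hm₁ : m₁ univ ≠ 0) (hmin₀ : ∀ z, m₀ ≤ T₀ z) (hmin₁ : ∀ z, m₁ ≤ T₁ z)
    (c : ℝ) :
    haveI := isMarkovKernel_switchKernel (κF := κF) (κR := κR) (c := c)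
      h.measurable_W h.measurable_s h.measurable_e
    haveI := isMarkovKernel_levelKernel T₀ T₁
    haveI := isProbabilityMeasure_jointLaw c ν₀ ν₁ h0
    ∀ᵐ z ∂(Kernel.trajMeasure (X := fun _ : ℕ => Bool × Ω)
        ((jointWeight c ν₀ ν₁ univ)⁻¹ • jointWeight c ν₀ ν₁)
        (fun n : ℕ => (switchKernel κF κR c W s e ∘ₖ levelKernel T₀ T₁).comap
          (fun hh : (j : ↥(Finset.Iic n)) → Bool × Ω => hh ⟨n, Finset.mem_Iic.2 le_rfl⟩)
          (measurable_pi_apply _))),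
      Tendsto (fun n : ℕ =>
          (∑ i ∈ range n, (targetLevel Ω).indicator (1 : Bool × Ω → ℝ) (z i) *
              (targetLevel Ω)ᶜ.indicator (1 : Bool × Ω → ℝ) (z (i + 1))) /
            ∑ i ∈ range n, (targetLevel Ω).indicator (1 : Bool × Ω → ℝ) (z i))
        atTop (𝓝 (∫ ε, min 1 (Real.exp (W ε - c)) ∂(fwdPathLaw ν₁ κR))) :=
  h.tendsto_revAcceptRate_ae_chain h0 h1 hT₀ hT₁ c
    (h.ergodic_ncmcChain h0 h1 hT₀ hT₁ hm₀ hm₁ hmin₀ hmin₁ c)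

end CrooksPair

end Summit.Ventures.LatticeQCDFlow.Exactness.GeneralNCMC
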